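import Summits.SmoothPoincare4.SmoothPoincare4.Theses.WeakReductionDescent
import Summits.SmoothPoincare4.SmoothPoincare4.Theorems.WeakReductionDescentLowGenusBase
import Literature.Topology.FourManifolds.SphereTrisectionsSectors
import Literature.Topology.FourManifolds.TrisectionFunctorGKNaturality
import Literature.Topology.FourManifolds.WeaklyReducibleTrisections
import Literature.Topology.FourManifolds.CircleSurgery
import Literature.Barriers.SmoothPoincare4.LowGenusTrisectionsStandardOfClassification

/-!
# Crux `WeakReductionReduces` (stmt-SmoothPoincare4-17908), line `loop_dichotomy`, stub D —
# auxiliary file 2: D at `g ≥ 4` is cut to the non-MSZ types (skeleton v3's glue)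

Stub D of the line (`stub_loopDichotomy`, v1/v2; Aranda–Zupan one dimension up, NO minimality: a
weakly reducible GK-trisection of genus `g` of a smooth homotopy `4`-sphere `M` is reducible, OR `M`
has a GK-trisection of genus `< g`, OR `M` is a surgery on a smoothly embedded loop in a closed smooth
`X` with a GK-trisection of genus `< g`) is only ever consumed at `g ≥ 4` by the line's composition.
Skeleton v3 (lead seat c1, `Cruxes/WeakReductionReduces/Lines/loop_dichotomy.lean`, sha 66732100…)
cuts that range by the two inputs any proof must use (the disprover's finding, `Disproof.lean` §A:
`e : M ≃ₕ S⁴` is load-bearing at every rung):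

* `χ(M) = 2` forces `k₀ + k₁ + k₂ = g` (Gay–Kirby Remark 2; PROVED in the tree,
  `gkTrisection_genus_eq_sum_of_homotopyEquiv_sphere_holds`, bare-binder form
  `Summit.SmoothPoincare4.SmoothPoincare4.Theorems.genus_eq_sum_of_isGKTrisection_of_homotopyEquiv`);
* if SOME `kᵢ + 1 ≥ g`, Meier–Schirmer–Zupan's classification (the tree's consolidated named fact
  `msz_trisection_classification_gk`, through the PROVED corollary
  `Literature.Barriers.SmoothPoincare4.msz_homotopySphere_gk_of_classification`) gives `M ≅ S⁴`, and
  Gay–Kirby's genus-`0` trisection of `S⁴` pulled back along the diffeomorphism is D's middle exit.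

What is left is D for the types with all `kᵢ + 2 ≤ g` (and `Σ kᵢ = g`): at `g = 4` the two types
`(2,1,1)`, `(2,2,0)` up to relabelling (registered stub `stub_loopDichotomyFour`, D₄ — "Aranda–Zupan
at genus 4 for homotopy spheres"), at `g ≥ 5` the registered stub `stub_loopDichotomyFromFive` (D₅).
This file lands the glue `helper_loopDichotomy_fromFour_of_core : MSZ16 Thm 1.2 → D₄ → D₅ → D(g ≥ 4)`
(registered helper of the crux; pure logic over PROVED tree theorems; CONDITIONAL on nothing — the
classification enters as an explicit hypothesis, to be fed by the stub / the fact's discharge).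

## References

* R. Aranda, A. Zupan, arXiv:2503.04607 (2025): Thm. 1.3 (p. 2), §5, §8 Prop. 8.1. [ArandaZupan2025]
* J. Meier, T. Schirmer, A. Zupan, Proc. AMS 144 (2016), arXiv:1507.06561: Thm. 1.2, Remark 3.12.
  [MeierSchirmerZupan2016]
* D. Gay, R. Kirby, Geom. Topol. 20 (2016): Remark 2, §2 (genus-0 trisection of `S⁴`). [GayKirby2016]
-/

-- the registered namespace `Summit.SmoothPoincare4.SmoothPoincare4.Theorems…` repeats a component
set_option linter.dupNamespace false

noncomputable section

open scoped Manifold ContDiff Topology ContinuousMap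
open Set
open Literature.Topology.FourManifolds
open Summit.SmoothPoincare4.SmoothPoincare4.Theses.WeakReductionDescent

namespace Summit.SmoothPoincare4.SmoothPoincare4.Theorems.WeakReductionReduces.LoopDichotomy

/-- **D's middle exit from a diffeomorphism to the round sphere**: along `Φ : M ≅ S⁴`, Gay–Kirby's
genus-`0` trisection of `S⁴` (`sphere_genusZero_gkTrisection_holds`, PROVED) pulls back to a
GK-trisection of `M` of genus `0 < g` (`IsGKTrisection.image_diffeomorph'`, PROVED).
[cite: GayKirby2016, §2 (first example)] -/
theorem exists_genus_lt_of_diffeomorph_sphere {M : Type} [TopologicalSpace M]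
    [ChartedSpace (EuclideanSpace ℝ (Fin 4)) M] [IsManifold (𝓡 4) ∞ M]
    (Φ : M ≃ₘ⟮𝓡 4, 𝓡 4⟯ (Metric.sphere (0 : EuclideanSpace ℝ (Fin 5)) 1)) {g : ℕ} (hg : 1 ≤ g) :
    ∃ (g₁ : ℕ) (k₁ : Fin 3 → ℕ) (T₁ : Fin 3 → Set M), g₁ < g ∧ IsGKTrisection M g₁ k₁ T₁ := by
  obtain ⟨S₀, hS₀⟩ := sphere_genusZero_gkTrisection_holds
  exact ⟨0, fun _ => 0, fun i => Φ.symm '' S₀ i, by omega, hS₀.isGKTrisection.image_diffeomorph' Φ.symm⟩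

/-- **`helper_loopDichotomy_fromFour_of_core` : MSZ16 Thm 1.2 → D₄ → D₅ → D at `g ≥ 4`**
(registered helper of crux stmt-SmoothPoincare4-17908; the glue of skeleton v3 of line
`loop_dichotomy`).  For a homotopy sphere `χ = 2` gives `Σ kᵢ = g`
(`genus_eq_sum_of_isGKTrisection_of_homotopyEquiv`, PROVED); if some `kᵢ + 1 ≥ g` the
classification yields `M ≅ S⁴` (`msz_homotopySphere_gk_of_classification`, PROVED from the
hypothesis `hC`; compactness from the trisection, simple connectivity and an orientation
transported along `e`) and the genus-`0` trisection of `S⁴` is the middle exit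
(`exists_genus_lt_of_diffeomorph_sphere`); otherwise all `kᵢ + 2 ≤ g`, and D₄ (at `g = 4`, where
then `kᵢ ≤ 2`) resp. D₅ (at `g ≥ 5`) apply verbatim.
[cite: MeierSchirmerZupan2016, Thm. 1.2 and Remark 3.12] [cite: GayKirby2016, Remark 2]
[cite: ArandaZupan2025, Thm. 1.3 (p. 2) and §5] -/
theorem helper_loopDichotomy_fromFour_of_core :
    Literature.Topology.FourManifolds.msz_trisection_classification_gk.{0} → (∀ (M : Type) [TopologicalSpace M] [T2Space M] [SecondCountableTopology M] [ChartedSpace (EuclideanSpace ℝ (Fin 4)) M] [IsManifold (𝓡 4) ((⊤ : ℕ∞) : WithTop ℕ∞) M], (M ≃ₕ (Metric.sphere (0 : EuclideanSpace ℝ (Fin 5)) 1)) → ∀ (k : Fin 3 → ℕ) (T : Fin 3 → Set M), Literature.Topology.FourManifolds.IsGKTrisection M 4 k T → k 0 + k 1 + k 2 = 4 → (∀ i, k i ≤ 2) → Literature.Topology.FourManifolds.Trisection.IsWeaklyReducible T → Literature.Topology.FourManifolds.Trisection.IsReducible T ∨ (∃ (g₁ : ℕ) (k₁ : Fin 3 →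 ℕ) (T₁ : Fin 3 → Set M), g₁ < 4 ∧ Literature.Topology.FourManifolds.IsGKTrisection M g₁ k₁ T₁) ∨ (∃ (X : Type) (_ : TopologicalSpace X) (_ : T2Space X) (_ : SecondCountableTopology X) (_ : ChartedSpace (EuclideanSpace ℝ (Fin 4)) X) (_ : IsManifold (𝓡 4) ((⊤ : ℕ∞) : WithTop ℕ∞) X) (g' : ℕ) (k' : Fin 3 → ℕ) (T' : Fin 3 → Set X) (ℓ : (Metric.sphere (0 : EuclideanSpace ℝ (Fin 2)) 1) → X), g' < 4 ∧ Literature.Topology.FourManifolds.IsGKTrisection X g' k' T' ∧ Manifold.IsSmoothEmbedding (𝓡 1) (𝓡 4) ((⊤ : ℕ∞) : WithTop ℕ∞) ℓ ∧ Literature.Topology.FourManifolds.IsCircleSurgery (𝓡 4) (𝓡 4) X M ℓ)) → (∀ (M : Type) [TopologicalSpace M] [T2Space M] [SecondCountableTopology M] [ChartedSpace (EuclideanSpace ℝ (Fin 4)) M] [IsManifold (𝓡 4) ((⊤ : ℕ∞) : WithTop ℕ∞) M], (M ≃ₕ (Metric.sphere (0 : EuclideanSpace ℝ (Fin 5)) 1))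 → ∀ (g : ℕ) (k : Fin 3 → ℕ) (T : Fin 3 → Set M), Literature.Topology.FourManifolds.IsGKTrisection M g k T → 5 ≤ g → k 0 + k 1 + k 2 = g → (∀ i, k i + 2 ≤ g) → Literature.Topology.FourManifolds.Trisection.IsWeaklyReducible T → Literature.Topology.FourManifolds.Trisection.IsReducible T ∨ (∃ (g₁ : ℕ) (k₁ : Fin 3 → ℕ) (T₁ : Fin 3 → Set M), g₁ < g ∧ Literature.Topology.FourManifolds.IsGKTrisection M g₁ k₁ T₁) ∨ (∃ (X : Type) (_ : TopologicalSpace X) (_ : T2Space X) (_ : SecondCountableTopology X) (_ : ChartedSpace (EuclideanSpace ℝ (Fin 4)) X) (_ : IsManifold (𝓡 4) ((⊤ : ℕ∞) : WithTop ℕ∞) X) (g' : ℕ) (k' : Fin 3 → ℕ) (T' : Fin 3 → Set X) (ℓ : (Metric.sphere (0 : EuclideanSpace ℝ (Fin 2)) 1) → X), g' < g ∧ Literature.Topology.FourManifolds.IsGKTrisection X g' k' T' ∧ Manifold.IsSmoothEmbedding (𝓡 1) (𝓡 4) ((⊤ : ℕ∞) : WithTop ℕ∞) ℓ ∧ Literature.Topology.FourManifolds.IsCircleSurgery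 (𝓡 4) (𝓡 4) X M ℓ)) → ∀ (M : Type) [TopologicalSpace M] [T2Space M] [SecondCountableTopology M] [ChartedSpace (EuclideanSpace ℝ (Fin 4)) M] [IsManifold (𝓡 4) ((⊤ : ℕ∞) : WithTop ℕ∞) M], (M ≃ₕ (Metric.sphere (0 : EuclideanSpace ℝ (Fin 5)) 1)) → ∀ (g : ℕ) (k : Fin 3 → ℕ) (T : Fin 3 → Set M), Literature.Topology.FourManifolds.IsGKTrisection M g k T → 4 ≤ g → Literature.Topology.FourManifolds.Trisection.IsWeaklyReducible T → Literature.Topology.FourManifolds.Trisection.IsReducible T ∨ (∃ (g₁ : ℕ) (k₁ : Fin 3 → ℕ) (T₁ : Fin 3 → Set M), g₁ < g ∧ Literature.Topology.FourManifolds.IsGKTrisection M g₁ k₁ T₁) ∨ (∃ (X : Type) (_ : TopologicalSpace X) (_ : T2Space X) (_ : SecondCountableTopology X) (_ : ChartedSpace (EuclideanSpace ℝ (Fin 4)) X) (_ : IsManifold (𝓡 4) ((⊤ : ℕ∞) : WithTop ℕ∞) X) (g' : ℕ) (k' : Fin 3 → ℕ) (T' : Fin 3 → Set X) (ℓ : (Metric.sphere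 (0 : EuclideanSpace ℝ (Fin 2)) 1) → X), g' < g ∧ Literature.Topology.FourManifolds.IsGKTrisection X g' k' T' ∧ Manifold.IsSmoothEmbedding (𝓡 1) (𝓡 4) ((⊤ : ℕ∞) : WithTop ℕ∞) ℓ ∧ Literature.Topology.FourManifolds.IsCircleSurgery (𝓡 4) (𝓡 4) X M ℓ) := by
  intro hC hD4 hD5 M _ _ _ _ _ e g k T hT hg hwr
  have hsum : g = k 0 + k 1 + k 2 :=
    Summit.SmoothPoincare4.SmoothPoincare4.Theorems.genus_eq_sum_of_isGKTrisection_of_homotopyEquiv M e hT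
  by_cases hk : ∃ i, g ≤ k i + 1
  · -- MSZ range: `M ≅ S⁴`, whose genus-0 trisection is the middle exit
    haveI : CompactSpace M := hT.compactSpace
    haveI : SimplyConnectedSpace (Metric.sphere (0 : EuclideanSpace ℝ (Fin 5)) 1) :=
      Literature.Topology.FourManifolds.simplyConnectedSpace_sphere_four_holds
    haveI : SimplyConnectedSpace M := e.simplyConnectedSpace
    obtain ⟨o⟩ := Literature.Topology.FourManifolds.isOrientable_of_homotopyEquiv_sphere_four_holds M e
    obtain ⟨Φ⟩ := Literature.Barriers.SmoothPoincare4.msz_homotopySphere_gk_of_classification hC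
      M o g k T hT hk e
    exact Or.inr (Or.inl (exists_genus_lt_of_diffeomorph_sphere Φ (by omega)))
  · push Not at hk
    have hk' : ∀ i, k i + 2 ≤ g := fun i => by have := hk i; omega
    rcases Nat.lt_or_ge g 5 with hg5 | hg5
    · obtain rfl : g = 4 := by omega
      exact hD4 M e k T hT (by omega) (fun i => by have := hk' i; omega) hwr
    · exact hD5 M e g k T hT hg5 (by omega) hk' hwr

end Summit.SmoothPoincare4.SmoothPoincare4.Theorems.WeakReductionReduces.LoopDichotomy

end
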